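import Mathlib
import HarnessLib
import HarnessLib.Audit
import Summits.SmoothPoincare4.Statement
import Summits.SmoothPoincare4.SmoothPoincare4.Theses.RootDecompAE
import Literature.Topology.FourManifolds.SmoothTriangulation
import Literature.Topology.FourManifolds.BalancedPresentation
import Literature.Topology.FourManifolds.PresentationHandlebodyFive
import Literature.Topology.FourManifolds.ClosedBall
import Literature.Topology.FourManifolds.CorkDecomposition

/-!
# LINE «grade-two-ac» for the crux `RootDecompAE.DoublesShadowTwo` (item stmt-SmoothPoincare4-32182)

Planner decomp-sp4-lens-1, generation 13 (lens «grading / quantitative ladder»), species R (recognition).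
Self-contained sibling of the registered grade-one line `Cruxes/DoublesShadowLEOne/Lines/grade_one_ac.lean`
(same model, same conventions; nothing is imported from it so that the two lines build independently).

The crux says: a double `X = D(C)` (`C` compact contractible) which is a homotopy 4-sphere, admits NO typed shadow of
connected complexity `≤ 1` but DOES admit one of connected complexity `≤ 2`, is diffeomorphic to `S⁴`.  As at grade one,
the OPEN content is a purely COMBINATORIAL Andrews–Curtis statement; what is new at grade two:

* §2  the PIECES now include the regular neighbourhoods of a singular component with TWO true vertices.  A connected
      4-regular graph on two vertices is a MELON (4 parallel edges) or a HANDCUFF (a loop at each vertex, two parallel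
      edges); decorating each edge with the bijection of the three sheets along it and dividing by the full symmetry group
      `S₄ × S₄ × C₂` (uniform relabelling of the edge germs at each vertex, vertex swap) gives **57 melon blocks and 116
      handcuff blocks** (gen13 `enum/blocks2v2.py`; the same enumeration returns KMN's ELEVEN figure-eight blocks at one
      vertex, arXiv:1803.06713 Prop. 4.1).  Their PORT WORDS live in `F₃ = π₁` of the 2-vertex graph (melon: `eᵢ ↦ xᵢ`
      (`i ≤ 3`), `e₄ ↦ 1`; handcuff: `ℓ₁ ↦ a`, `c ↦ b`, `d ↦ 1`, `ℓ₂ ↦ c`); 1–6 ports per block, total strip length 12.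
* §3  `ShadowGraph` with THREE spine letters per piece (unused letters killed), otherwise verbatim.
* §4  FOUR registered stubs and the sorry-free composition `DoublesShadowTwo_of` concluding the crux BY NAME:
      STUB 1 `stub_kmnGraphPresentationTwo` (STRUCTURE at `c* ≤ 2`: the Prop-4.1 analogue with the 173 blocks + KMN §1.2 /
      Turaev `N(X) × I = H⁵(P(X))`; size L; the block enumeration of §2 is the part not in print);
      STUB 2 `stub_gradeTwoDichotomy` (LOAD-BEARING, combinatorial): an admissible graph whose presentation presents the
      trivial group carries a RECURSIVE ONE-OCCURRENCE ELIMINATION certificate (§4a) — the gen13 OWNERSHIP proof plan: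
      cut excesses ∈ {0,1} (else `H₁ ≠ 0`), canonical edge ownership, `|det M| = ∏ local minors`, and the finite LOCAL TABLE
      «every unimodular owned triple of every block is eliminable» (88/88; exactly 5 of them are NOT letter-triangular,
      which is where the grade-one ERASURE certificate of gen 12 stops); census: 0 failures on 755 449 encoding graphs (22 censuses);
      the same local table holds at grade THREE (47 520 owned 4-tuples of all 3-vertex blocks, 17 800 unimodular, all eliminable)
      and FAILS at grade five (the K₅ special spine of the Poincaré sphere, Matveev 2007 §2.3.3.D: a 6-port block whose capped
      presentation is unimodular and presents the binary icosahedral group) — the abelian local-to-global mechanism of this line is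
      complete exactly for connected complexity ≤ 3 (4: sampled, 10⁶ blocks, no failure);
      STUB 3 `stub_roeSound` (pure free-group algebra, size M): an elimination certificate implies Andrews–Curtis
      triviality — each step is a multiplication by an element of the normal closure of the defining relator
      (`BalancedPresentation.update_mul_of_mem_normalClosure`) and the final tuple `(x_t · V_t)` with `V_t` a word in the
      letters eliminated LATER is erasure-triangular for the reversed order (`isAndrewsCurtisEquivalent_trivial_of_isConj_erase`,
      `TriangularPresentationAndrewsCurtis.lean`); no change of basis and no stabilisation is needed;
      STUB 4 `stub_acFiveBall` = the tree's NAMED FACT `IsPresentationHandlebodyFive.nonempty_diffeomorph_closedBall_of_…` by name.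
-/

open scoped Manifold ContDiff ContinuousMap Topology
open Literature.Topology.FourManifolds

set_option linter.dupNamespace false

noncomputable section

namespace Summit.SmoothPoincare4.SmoothPoincare4.Cruxes.DoublesShadowTwo.GradeTwoAC

/-! ## §1 The typed object (verbatim copy of the grade-one line §1 / gen10 ShadowDoubles.lean §1) -/

section Typed

variable (n : ℕ) (M : Type*) [TopologicalSpace M] [ChartedSpace (EuclideanSpace ℝ (Fin 4)) M]

/-- `HasConnectedShadowComplexityLE n M`: the smooth 4-manifold `M` admits a (combinatorially presented, locally
flat) shadow of connected complexity `c* ≤ n` (Martelli arXiv:0909.0168 Def 3.1/Rem 3.10; KMN arXiv:1803.06713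
§2.1–2.2, Def 2.1; Koda–Naoe arXiv:1905.00809 p.4). -/
def HasConnectedShadowComplexityLE : Prop :=
  ∃ (N : ℕ) (K : Geometry.SimplicialComplex ℝ (EuclideanSpace ℝ (Fin N))) (h : K.space ≃ₜ M)
    (P : Set (Finset (EuclideanSpace ℝ (Fin N)))),
    IsSmoothTriangulation 4 K h ∧
    P ⊆ K.faces ∧
    (∀ s ∈ P, ∀ t, t ⊆ s → t.Nonempty → t ∈ P) ∧
    (∀ s ∈ P, s.card ≤ 3) ∧
    (∀ s ∈ K.faces, (∀ v ∈ s, ({v} : Finset (EuclideanSpace ℝ (Fin N))) ∈ P) → s ∈ P) ∧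
    (∃ G : Set (Finset (EuclideanSpace ℝ (Fin N))), (∀ s ∈ G, s.card ≤ 2) ∧
      Relation.ReflTransGen
        (fun F G : Set (Finset (EuclideanSpace ℝ (Fin N))) => ∃ σ τ : Finset (EuclideanSpace ℝ (Fin N)),
          (σ ∈ F ∧ τ ∈ F ∧ σ ⊂ τ ∧ τ.card = σ.card + 1 ∧ ∀ ρ ∈ F, σ ⊂ ρ → ρ = τ) ∧ G = F \ {σ, τ})
        {s | s ∈ K.faces ∧ ∀ v ∈ s, ({v} : Finset (EuclideanSpace ℝ (Fin N))) ∉ P} G) ∧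
    (∀ x : M, x ∈ h '' {y : K.space | ∃ s ∈ P, (y : EuclideanSpace ℝ (Fin N)) ∈ convexHull ℝ (s : Set (EuclideanSpace ℝ (Fin N)))} →
      ∃ U : Set M, IsOpen U ∧ x ∈ U ∧ ∃ f : M → ℝ, ContMDiffOn (𝓡 4) 𝓘(ℝ, ℝ) ∞ f U ∧
        mfderiv (𝓡 4) 𝓘(ℝ, ℝ) f x ≠ 0 ∧
        ∀ y ∈ U, y ∈ h '' {y : K.space | ∃ s ∈ P, (y : EuclideanSpace ℝ (Fin N)) ∈ convexHull ℝ (s : Set (EuclideanSpace ℝ (Fin N)))} →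
          f y = 0) ∧
    (let L : (v : EuclideanSpace ℝ (Fin N)) →
        SimpleGraph {u : EuclideanSpace ℝ (Fin N) // u ≠ v ∧ ({u, v} : Finset (EuclideanSpace ℝ (Fin N))) ∈ P} :=
      (fun v => SimpleGraph.fromRel fun u w => ({u.1, w.1, v} : Finset (EuclideanSpace ℝ (Fin N))) ∈ P);
    let tetra : EuclideanSpace ℝ (Fin N) → Prop := (fun v =>
      (L v).Connected ∧ ∃ B : Finset {u : EuclideanSpace ℝ (Fin N) // u ≠ v ∧ ({u, v} : Finset (EuclideanSpace ℝ (Fin N))) ∈ P},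
        B.card = 4 ∧ (∀ u, u ∈ B ↔ ((L v).neighborSet u).ncard = 3) ∧ (∀ u, u ∉ B → ((L v).neighborSet u).ncard = 2) ∧
        ∀ a ∈ B, ∀ b ∈ B, a ≠ b →
          ∃ S : Set {u : EuclideanSpace ℝ (Fin N) // u ≠ v ∧ ({u, v} : Finset (EuclideanSpace ℝ (Fin N))) ∈ P},
            a ∈ S ∧ b ∈ S ∧ (∀ u ∈ S, u ∈ B → u = a ∨ u = b) ∧ ((L v).induce S).Connected);
    (∀ v, ({v} : Finset (EuclideanSpace ℝ (Fin N))) ∈ P →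
        ((L v).Connected ∧ ∀ u, ((L v).neighborSet u).ncard = 2) ∨
        ((L v).Connected ∧ ∃ a b, a ≠ b ∧ ((L v).neighborSet a).ncard = 3 ∧ ((L v).neighborSet b).ncard = 3 ∧
          (∀ u, u ≠ a → u ≠ b → ((L v).neighborSet u).ncard = 2) ∧
          ((L v).induce {w | w ≠ a}).Connected ∧ ((L v).induce {w | w ≠ b}).Connected) ∨
        tetra v) ∧
      ∀ a, tetra a →
        {b | (SimpleGraph.fromRel fun u w : EuclideanSpace ℝ (Fin N) =>
              {x | x ≠ u ∧ x ≠ w ∧ ({u, w, x} : Finset (EuclideanSpace ℝ (Fin N))) ∈ P}.ncard = 3).Reachable a b ∧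
            tetra b}.ncard ≤ n)

end Typed

/-! ## §2 Pieces at connected complexity ≤ 2 and their port words -/

/-- Spine letters `a, b, c` of a piece (three letters for every piece; a piece of rank `r` uses the first `r`). -/
def la : FreeGroup (Fin 3) := FreeGroup.of 0
/-- Second spine letter. -/
def lb : FreeGroup (Fin 3) := FreeGroup.of 1
/-- Third spine letter (used only by the two-vertex blocks, rank 3). -/
def lc : FreeGroup (Fin 3) := FreeGroup.of 2

/-- PORT TABLE of the eleven figure-eight blocks (KMN Prop. 4.1; grade-one line §2, same numbering). -/
def x8Ports : Fin 11 → List (FreeGroup (Fin 3)) :=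
  ![ [la, la * lb * la⁻¹ * lb⁻¹, lb],
     [la, la * lb * lb * la⁻¹ * lb⁻¹],
     [la, la * lb * la * lb⁻¹, lb],
     [la, la * lb * lb * la * lb⁻¹],
     [la, la * lb⁻¹ * lb⁻¹ * la⁻¹ * lb⁻¹],
     [la, la * lb⁻¹, la * lb, lb],
     [la, la * lb⁻¹, la * lb * lb],
     [la * lb * lb * la⁻¹ * lb⁻¹ * la],
     [la * lb * lb * la * lb⁻¹ * la],
     [la * lb * lb * la, la * lb⁻¹],
     [la * lb * la, la * lb⁻¹ * lb⁻¹] ]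

/-- PORT TABLE of the 57 MELON blocks (two true vertices joined by four singular edges `e₁, …, e₄`; sheets at a vertex =
2-subsets of the four edge germs; block = the four sheet bijections along the edges modulo `S₄ × S₄ × C₂`; port word =
boundary circle of the regular neighbourhood read in `F₃ = ⟨x₁, x₂, x₃⟩`, `eᵢ ↦ xᵢ`, `e₄ ↦ 1`).  Index = position in
gen13 `enum/blocks2v2_melon.json` (sorted by number of ports, then words); ports per block 1–6. -/
def melonPorts : Fin 57 → List (FreeGroup (Fin 3)) :=
  ![[lb * lc⁻¹ * la * la * lc⁻¹ * lb⁻¹ * lc⁻¹ * lb * la⁻¹],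
     [lb * lc⁻¹ * la * lc * lb * la * lc⁻¹ * lb * la⁻¹],
     [lb * lc⁻¹ * la⁻¹ * lc * la⁻¹ * lb⁻¹ * lc⁻¹ * lb * la⁻¹],
     [lb * lc⁻¹ * la * lc⁻¹ * la⁻¹ * lb⁻¹ * lc⁻¹ * lb * la⁻¹],
     [lb * lc⁻¹ * la * lc * la⁻¹ * lb⁻¹ * lc⁻¹ * lb * la⁻¹],
     [lb * lc⁻¹ * la⁻¹ * lb⁻¹ * lc * la⁻¹ * lc * lb * la⁻¹],
     [lb * lc⁻¹ * la * lc⁻¹ * la⁻¹ * lb⁻¹ * lc * lb * la⁻¹],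
     [lb * lc⁻¹ * la * lc * la⁻¹ * lb⁻¹ * lc * lb * la⁻¹],
     [lb * lc⁻¹ * la⁻¹ * lc * la * lc⁻¹ * lb * lb * la⁻¹],
     [lb * lc⁻¹ * la * lc⁻¹ * lb⁻¹ * la⁻¹ * lc⁻¹ * lb * la⁻¹],
     [lb * lc⁻¹ * la * lb * lc * la⁻¹ * lc⁻¹ * lb * la⁻¹],
     [lb * lc⁻¹ * la * lc * la⁻¹ * lc⁻¹ * lb * lb * la⁻¹],
     [lb * lc⁻¹ * la * lb * la⁻¹ * lc⁻¹ * lb * lc * la⁻¹],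
     [lb * lc⁻¹ * lb⁻¹ * lc⁻¹ * lb * la⁻¹, lc * la⁻¹ * la⁻¹],
     [lb * lc⁻¹ * la * lc⁻¹ * lc⁻¹ * lb * la⁻¹, lb⁻¹ * la⁻¹],
     [lb * lc⁻¹ * lc⁻¹ * lb * la⁻¹, lc * la⁻¹ * lb⁻¹ * la⁻¹],
     [lb * lc⁻¹ * la * lc⁻¹ * lb * la⁻¹, lb⁻¹ * lc⁻¹ * la⁻¹],
     [lb * lc⁻¹ * lb * la⁻¹, lc * lb * la * lc⁻¹ * la⁻¹],
     [lb * la⁻¹, lc * lb⁻¹ * lc * lb * la * lc * la⁻¹],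
     [lb * lc⁻¹ * la⁻¹ * lc * lb * la⁻¹, lb⁻¹ * lc * la⁻¹],
     [lb * lc⁻¹ * la * lc * lb * la⁻¹, lb⁻¹ * lc * la⁻¹],
     [lb * la⁻¹, lc * lb⁻¹ * lc⁻¹ * la⁻¹ * lb⁻¹ * lc * la⁻¹],
     [lb * lc⁻¹ * la * lc * la⁻¹, lb⁻¹ * lc * lb * la⁻¹],
     [lb * la⁻¹, lc * la⁻¹ * lb⁻¹ * lc * lb * lc⁻¹ * la⁻¹],
     [lb * la⁻¹, lc * lb⁻¹ * lc⁻¹ * lb * la * lc * la⁻¹],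
     [lb * la⁻¹, lc * lb⁻¹ * lc⁻¹ * lb * la * lc⁻¹ * la⁻¹],
     [lb * la⁻¹, lc * la⁻¹ * lb⁻¹ * lc * lc * lb⁻¹ * la⁻¹],
     [lb * lc⁻¹ * la * lb * la⁻¹, lc⁻¹ * lb⁻¹ * lc * la⁻¹],
     [lb * lc⁻¹ * lb * lb * la⁻¹, lc * la * lc⁻¹ * la⁻¹],
     [lb * lc⁻¹ * la * lc⁻¹ * la⁻¹ * lc⁻¹ * lb * la⁻¹, lb⁻¹],
     [lb * la⁻¹, lc * lb⁻¹ * lc * la * lb * lc * la⁻¹],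
     [lb * la⁻¹, lc * la⁻¹ * lc⁻¹ * lb * lb * lc⁻¹ * la⁻¹],
     [lb * la⁻¹, lc * lb⁻¹ * lb⁻¹ * lc * la * lc * la⁻¹],
     [lb * lc⁻¹ * la * lb * la⁻¹, lc⁻¹ * lb * lc * la⁻¹],
     [lb * la⁻¹, lc * lb⁻¹ * la⁻¹ * lc⁻¹ * lb * lc * la⁻¹],
     [lb * la⁻¹, lc * la⁻¹ * la⁻¹, lc * lb * lc⁻¹ * lb⁻¹],
     [lb * lc⁻¹ * la * lc⁻¹ * lb * la⁻¹, lb⁻¹ * la⁻¹, lc⁻¹],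
     [lb * lc⁻¹ * lb * la⁻¹, lc * lc * la⁻¹, lb⁻¹ * la⁻¹],
     [lb * la⁻¹, lc * lb⁻¹ * lc * la⁻¹, lb⁻¹ * lc⁻¹ * la⁻¹],
     [lb * la⁻¹, lc * la⁻¹, lb⁻¹ * lc⁻¹ * lb * lc⁻¹ * la⁻¹],
     [lb * la⁻¹, lc * lb⁻¹ * lc⁻¹ * la⁻¹, lb⁻¹ * lc * la⁻¹],
     [lb * la⁻¹, lc * lb⁻¹ * la⁻¹ * lb⁻¹ * lc * la⁻¹, lc⁻¹],
     [lb * la⁻¹, lc * la⁻¹, lb⁻¹ * lc * lb * lc⁻¹ * la⁻¹],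
     [lb * la⁻¹, lc * la⁻¹, lb⁻¹ * lc * lc * lb⁻¹ * la⁻¹],
     [lb * la⁻¹, lc * lb⁻¹ * lb⁻¹ * lc * la⁻¹, lc⁻¹ * la⁻¹],
     [lb * la⁻¹, lc * la * lc * la⁻¹, lc * lb⁻¹ * lb⁻¹],
     [lb * lc * la⁻¹, lc * lb⁻¹ * la⁻¹, lc⁻¹ * lb * la⁻¹],
     [lb * la⁻¹, lc * lb⁻¹ * la⁻¹, lc⁻¹ * lb * lc * la⁻¹],
     [lb * la⁻¹, lc * la⁻¹, la⁻¹, lc * lb * lc * lb⁻¹],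
     [lb * la⁻¹, lc * la⁻¹, la⁻¹, lc * lb * lc⁻¹ * lb⁻¹],
     [lb * la⁻¹, lc * la⁻¹, lb⁻¹ * la⁻¹, lc * lc * lb⁻¹],
     [lb * la⁻¹, lc * lb⁻¹ * lc * la⁻¹, lb⁻¹ * la⁻¹, lc⁻¹],
     [lb * la⁻¹, lc * la⁻¹, lb⁻¹ * lc⁻¹ * la⁻¹, lc * lb⁻¹],
     [lb * la⁻¹, lc * lb⁻¹ * la⁻¹, lb⁻¹ * lc * la⁻¹, lc⁻¹],
     [lb * la⁻¹, lc * la⁻¹, lc⁻¹ * lb * lc⁻¹ * la⁻¹, lb⁻¹],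
     [lb * la⁻¹, lc * la⁻¹, la⁻¹, lc * lb⁻¹, lc⁻¹ * lb⁻¹],
     [lb * la⁻¹, lc * la⁻¹, la⁻¹, lc * lb⁻¹, lb⁻¹, lc⁻¹] ]

/-- PORT TABLE of the 116 HANDCUFF blocks (a loop `ℓ₁` at the first vertex, a loop `ℓ₂` at the second, two edges `c, d`
between them; `F₃ = ⟨a, b, c⟩` with `ℓ₁ ↦ a`, `c ↦ b`, `d ↦ 1`, `ℓ₂ ↦ c`).  Index = position in gen13
`enum/blocks2v2_handcuff.json`; ports per block 1–5. -/
def handcuffPorts : Fin 116 → List (FreeGroup (Fin 3)) :=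
  ![[la⁻¹ * lc⁻¹ * lb⁻¹ * la * lb⁻¹ * lc * lc * lb⁻¹ * la⁻¹],
     [la⁻¹ * lc⁻¹ * lb⁻¹ * la * lc * lc * lb⁻¹ * lb⁻¹ * la⁻¹],
     [la⁻¹ * lc⁻¹ * lb⁻¹ * lc * lc * lb⁻¹ * la * lb⁻¹ * la⁻¹],
     [la⁻¹ * lb * lc⁻¹ * lc⁻¹ * la⁻¹ * lc⁻¹ * lb⁻¹ * lb⁻¹ * la⁻¹],
     [la⁻¹ * lb * lc⁻¹ * lc⁻¹ * la * lc⁻¹ * lb⁻¹ * lb⁻¹ * la⁻¹],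
     [la⁻¹ * lb * lc⁻¹ * lc⁻¹ * lb * lc * la⁻¹ * lb⁻¹ * la⁻¹],
     [la⁻¹ * lb * lc⁻¹ * lc⁻¹ * lb * lc * la * lb⁻¹ * la⁻¹],
     [la⁻¹ * lb * lc * la⁻¹ * lb⁻¹ * lc * lc * lb⁻¹ * la⁻¹],
     [la⁻¹ * lb * lc * la⁻¹ * lc * lc * lb⁻¹ * lb⁻¹ * la⁻¹],
     [la⁻¹ * lb * lc * lb⁻¹ * lc⁻¹ * lc⁻¹ * la * lb⁻¹ * la⁻¹],
     [la⁻¹ * lb * lc * lb⁻¹ * lc * lc * la⁻¹ * lb⁻¹ * la⁻¹],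
     [la⁻¹ * lb * lc * lb⁻¹ * lc * lc * la * lb⁻¹ * la⁻¹],
     [la⁻¹ * lb * lc * la * lb⁻¹ * lc * lc * lb⁻¹ * la⁻¹],
     [la⁻¹ * lb * lc * la * lc * lc * lb⁻¹ * lb⁻¹ * la⁻¹],
     [la⁻¹ * lb * lc * lb * la⁻¹ * lc * lc * lb⁻¹ * la⁻¹],
     [la⁻¹ * lb * lc * lb * lc⁻¹ * lc⁻¹ * la⁻¹ * lb⁻¹ * la⁻¹],
     [la⁻¹ * lb * lc * lb * lc⁻¹ * lc⁻¹ * la * lb⁻¹ * la⁻¹],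
     [la⁻¹ * lb * lc * lb * la * lc * lc * lb⁻¹ * la⁻¹],
     [la⁻¹ * lb * lc * lc * lb⁻¹ * lc⁻¹ * la * lb⁻¹ * la⁻¹],
     [la⁻¹ * lb * lc * lc * lb⁻¹ * lc * la⁻¹ * lb⁻¹ * la⁻¹],
     [la⁻¹ * lb * lc * lc * lb⁻¹ * lc * la * lb⁻¹ * la⁻¹],
     [la⁻¹ * lc * lc * lb⁻¹ * lc⁻¹ * lb⁻¹ * la * lb⁻¹ * la⁻¹],
     [la⁻¹ * lc * lc * lb⁻¹ * la * lb⁻¹ * lc⁻¹ * lb⁻¹ * la⁻¹],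
     [la⁻¹, lb * lc * lb * lc⁻¹ * lc⁻¹ * la⁻¹ * lb⁻¹ * la⁻¹],
     [la⁻¹, lb * lc * lc * lb⁻¹ * lc⁻¹ * la⁻¹ * lb⁻¹ * la⁻¹],
     [la⁻¹, lb * lc * lc * lb⁻¹ * lc * la⁻¹ * lb⁻¹ * la⁻¹],
     [la⁻¹, lb * lc * lb * la * lc * lc * lb⁻¹ * la⁻¹],
     [la⁻¹, lb * lc * lb * la * lb * lc⁻¹ * lc⁻¹ * la⁻¹],
     [la⁻¹, lb * lc * la⁻¹ * lb⁻¹ * lc * lc * lb⁻¹ * la⁻¹],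
     [la⁻¹, lb * lc * lc * lb⁻¹ * lb⁻¹ * la⁻¹ * lc⁻¹ * la⁻¹],
     [la⁻¹, lb * lc * la * lb * lc⁻¹ * lc⁻¹ * lb * la⁻¹],
     [la⁻¹, lb * lc * la * lb⁻¹ * lc * lc * lb⁻¹ * la⁻¹],
     [la⁻¹, lb * lc * lc * lb⁻¹ * la⁻¹ * lc⁻¹ * lb * la⁻¹],
     [la⁻¹, lb * lc * lc * lb⁻¹ * lc * la * lb * la⁻¹],
     [la⁻¹, lb * lc * lc * lb⁻¹ * lc * la * lb⁻¹ * la⁻¹],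
     [la⁻¹, lb * lc * lb * la⁻¹ * lc * lc * lb⁻¹ * la⁻¹],
     [la⁻¹, lb * lc * lb * lc⁻¹ * lc⁻¹ * la * lb⁻¹ * la⁻¹],
     [la⁻¹, lb * lc * lb * lc⁻¹ * lc⁻¹ * la * lb * la⁻¹],
     [la⁻¹, lb * lc * lc * lb⁻¹ * la⁻¹ * lc * lb * la⁻¹],
     [la⁻¹, lb * lc * lc * lb⁻¹ * lb⁻¹ * la⁻¹ * lc * la⁻¹],
     [la⁻¹, lb * lc * lc * lb⁻¹ * lc⁻¹ * la * lb⁻¹ * la⁻¹],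
     [la⁻¹, lb * lc * lc * lb⁻¹ * lc⁻¹ * la * lb * la⁻¹],
     [la⁻¹ * lb⁻¹ * lc * lc * lb⁻¹ * la⁻¹, lb * lc * la⁻¹],
     [la⁻¹ * lc⁻¹ * lb⁻¹ * la⁻¹, lb * lc⁻¹ * lc⁻¹ * lb * la⁻¹],
     [la⁻¹ * lc⁻¹ * lb⁻¹ * la * lb⁻¹ * la⁻¹, lc * lc * lb⁻¹],
     [la⁻¹ * lc⁻¹ * lb⁻¹ * la * lc * lc * lb⁻¹ * la⁻¹, lb⁻¹],
     [la⁻¹ * lb * lc⁻¹ * lc⁻¹ * la⁻¹ * lb⁻¹ * la⁻¹, lc⁻¹ * lb⁻¹],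
     [la⁻¹ * lb * lc⁻¹ * lc⁻¹ * la * lb⁻¹ * la⁻¹, lc⁻¹ * lb⁻¹],
     [la⁻¹ * lb * lc * la⁻¹ * lb⁻¹ * la⁻¹, lc * lc * lb⁻¹],
     [la⁻¹ * lb * lc * la⁻¹ * lc * lc * lb⁻¹ * la⁻¹, lb⁻¹],
     [la⁻¹ * lb * lc * lb⁻¹ * la⁻¹, lc⁻¹ * lc⁻¹ * lb * la⁻¹],
     [la⁻¹ * lb * lc * lb⁻¹ * la⁻¹, lc * lc * lb * la⁻¹],
     [la⁻¹ * lb * lc * la * lb⁻¹ * la⁻¹, lc * lc * lb⁻¹],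
     [la⁻¹ * lb * lc * la * lc * lc * lb⁻¹ * la⁻¹, lb⁻¹],
     [la⁻¹ * lb * lc * lc * lb⁻¹ * la⁻¹, lc⁻¹ * lb * la⁻¹],
     [la⁻¹ * lb * lc * lc * lb⁻¹ * la⁻¹, lc * lb * la⁻¹],
     [la⁻¹ * lb * lc * lc * lb⁻¹ * lb⁻¹ * la⁻¹, lc⁻¹ * la⁻¹],
     [la⁻¹ * lb * lc * lc * lb⁻¹ * lb⁻¹ * la⁻¹, lc * la⁻¹],
     [la⁻¹ * lc * lc * lb⁻¹ * la⁻¹, lb * lc * lb * la⁻¹],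
     [la⁻¹ * lc * lc * lb⁻¹ * la * lb⁻¹ * la⁻¹, lc⁻¹ * lb⁻¹],
     [la⁻¹, lb * lc * lb * lc⁻¹ * lc⁻¹ * la⁻¹, lb⁻¹ * la⁻¹],
     [la⁻¹, lb * lc * lc * lb⁻¹ * lc⁻¹ * la⁻¹, lb⁻¹ * la⁻¹],
     [la⁻¹, lb * lc * lc * lb⁻¹ * lc * la⁻¹, lb⁻¹ * la⁻¹],
     [la⁻¹, lb * lc⁻¹ * lc⁻¹ * la⁻¹ * lb⁻¹ * la⁻¹, lc⁻¹ * lb⁻¹],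
     [la⁻¹, lb * lc * la⁻¹ * lb⁻¹ * la⁻¹, lc * lc * lb⁻¹],
     [la⁻¹, lb * lc * lb⁻¹ * lc * la⁻¹ * lb⁻¹ * la⁻¹, lc⁻¹],
     [la⁻¹, lb * lc * lb * lc⁻¹ * la⁻¹ * lb⁻¹ * la⁻¹, lc⁻¹],
     [la⁻¹, lb * lc * la⁻¹, lb⁻¹ * lc * lc * lb⁻¹ * la⁻¹],
     [la⁻¹, lb * lc * lc * lb⁻¹ * lb⁻¹ * la⁻¹, lc⁻¹ * la⁻¹],
     [la⁻¹, lb * lc * lc * lb⁻¹ * la⁻¹ * lc⁻¹ * la⁻¹, lb⁻¹],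
     [la⁻¹, lb * lc * la * lb * la⁻¹, lc * lc * lb⁻¹],
     [la⁻¹, lb * lc * la * lb * lc⁻¹ * lb * la⁻¹, lc⁻¹],
     [la⁻¹, lb * lc * la * lb⁻¹ * la⁻¹, lc * lc * lb⁻¹],
     [la⁻¹, lb * lc * la * lc * lc * lb⁻¹ * la⁻¹, lb⁻¹],
     [la⁻¹, lb * lc * la * lb⁻¹ * lc * lb⁻¹ * la⁻¹, lc⁻¹],
     [la⁻¹, lb * lc * la * lb * lc⁻¹ * lc⁻¹ * la⁻¹, lb⁻¹],
     [la⁻¹, lb * lc * lc * lb⁻¹ * la⁻¹, lc⁻¹ * lb * la⁻¹],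
     [la⁻¹, lb * lc * lb⁻¹ * lc * la * lb⁻¹ * la⁻¹, lc⁻¹],
     [la⁻¹, lb * lc⁻¹ * lc⁻¹ * la * lb⁻¹ * la⁻¹, lc⁻¹ * lb⁻¹],
     [la⁻¹, lb * lc⁻¹ * lc⁻¹ * la * lb * la⁻¹, lc⁻¹ * lb⁻¹],
     [la⁻¹, lb * lc * la⁻¹ * lc * lc * lb⁻¹ * la⁻¹, lb⁻¹],
     [la⁻¹, lb * lc * lb⁻¹ * lc⁻¹ * la * lb⁻¹ * la⁻¹, lc⁻¹],
     [la⁻¹, lb * lc * lb * la⁻¹, lc * lc * lb⁻¹ * la⁻¹],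
     [la⁻¹, lb * lc * lb * la⁻¹ * lc * lb⁻¹ * la⁻¹, lc⁻¹],
     [la⁻¹, lb * lc * lb * lc⁻¹ * la * lb⁻¹ * la⁻¹, lc⁻¹],
     [la⁻¹, lb * lc * lb * lc⁻¹ * la * lb * la⁻¹, lc⁻¹],
     [la⁻¹, lb * lc * lc * lb⁻¹ * la⁻¹, lc * lb * la⁻¹],
     [la⁻¹, lb * lc * lc * lb⁻¹ * la⁻¹ * lc * la⁻¹, lb⁻¹],
     [la⁻¹, lb * lc * lc * lb⁻¹ * lb⁻¹ * la⁻¹, lc * la⁻¹],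
     [la⁻¹ * lb⁻¹ * la⁻¹, lb * lc⁻¹ * lc⁻¹ * la⁻¹, lc⁻¹ * lb⁻¹],
     [la⁻¹ * lb⁻¹ * la⁻¹, lb * lc * la⁻¹, lc * lc * lb⁻¹],
     [la⁻¹ * lc⁻¹ * lb⁻¹ * la⁻¹, lb * lc⁻¹ * lc⁻¹ * la⁻¹, lb⁻¹],
     [la⁻¹ * lb * lc * lb⁻¹ * la⁻¹, lc⁻¹ * lc⁻¹ * la⁻¹, lb⁻¹],
     [la⁻¹ * lb * lc * lb⁻¹ * la⁻¹, lc * lc * la⁻¹, lb⁻¹],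
     [la⁻¹ * lb * lc * lc * lb⁻¹ * la⁻¹, lc⁻¹ * la⁻¹, lb⁻¹],
     [la⁻¹ * lb * lc * lc * lb⁻¹ * la⁻¹, lc * la⁻¹, lb⁻¹],
     [la⁻¹ * lc * lc * lb⁻¹ * la⁻¹, lb * la⁻¹, lc⁻¹ * lb⁻¹],
     [la⁻¹ * lc * lc * lb⁻¹ * la⁻¹, lb * lc * la⁻¹, lb⁻¹],
     [la⁻¹, lb * lc⁻¹ * lc⁻¹ * la⁻¹, lb⁻¹ * la⁻¹, lc⁻¹ * lb⁻¹],
     [la⁻¹, lb * lc * la⁻¹, lb⁻¹ * la⁻¹, lc * lc * lb⁻¹],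
     [la⁻¹, lb * lc * la⁻¹ * lb⁻¹ * la⁻¹, lc * lb⁻¹, lc⁻¹],
     [la⁻¹, lb * lc * lc * lb⁻¹ * la⁻¹, lc⁻¹ * la⁻¹, lb⁻¹],
     [la⁻¹, lb * lc * la * lb * la⁻¹, lc * lb⁻¹, lc⁻¹],
     [la⁻¹, lb * lc * la * lb⁻¹ * la⁻¹, lc * lb⁻¹, lc⁻¹],
     [la⁻¹, lb * lc * la * lc * lb⁻¹ * la⁻¹, lb⁻¹, lc⁻¹],
     [la⁻¹, lb * lc * la * lb * lc⁻¹ * la⁻¹, lb⁻¹, lc⁻¹],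
     [la⁻¹, lb * lc * lb⁻¹ * la⁻¹, lc⁻¹ * lb * la⁻¹, lc⁻¹],
     [la⁻¹, lb * lc * la⁻¹, lc * lc * lb⁻¹ * la⁻¹, lb⁻¹],
     [la⁻¹, lb * lc * la⁻¹ * lc * lb⁻¹ * la⁻¹, lb⁻¹, lc⁻¹],
     [la⁻¹, lb * lc * lb⁻¹ * la⁻¹, lc * lb * la⁻¹, lc⁻¹],
     [la⁻¹, lb * lc * lb * la⁻¹, lc * lb⁻¹ * la⁻¹, lc⁻¹],
     [la⁻¹, lb * lc * lc * lb⁻¹ * la⁻¹, lc * la⁻¹, lb⁻¹],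
     [la⁻¹, lb * lc * la⁻¹, lb⁻¹ * la⁻¹, lc * lb⁻¹, lc⁻¹],
     [la⁻¹, lb * lc * lb⁻¹ * la⁻¹, lc⁻¹ * la⁻¹, lb⁻¹, lc⁻¹],
     [la⁻¹, lb * lc * la⁻¹, lc * lb⁻¹ * la⁻¹, lb⁻¹, lc⁻¹],
     [la⁻¹, lb * lc * lb⁻¹ * la⁻¹, lc * la⁻¹, lb⁻¹, lc⁻¹] ]

/-- The pieces of a simple polyhedron of connected complexity ≤ 2: KMN's grade ≤ 1 pieces and the 57 + 116 two-vertex blocks. -/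
inductive Piece : Type
  | disc
  | pants
  | moebius
  | y111
  | y12
  | y3
  | x8 (i : Fin 11)
  | melon (i : Fin 57)
  | handcuff (i : Fin 116)
  deriving DecidableEq

namespace Piece

/-- Rank of the free fundamental group of the piece's spine (point, circle, figure-eight, 2-vertex 4-regular graph). -/
def rank : Piece → ℕ
  | disc => 0
  | pants => 2
  | moebius => 1
  | y111 => 1
  | y12 => 1
  | y3 => 1
  | x8 _ => 2
  | melon _ => 3
  | handcuff _ => 3

/-- Port words of every piece (as in the grade-one line, with the two block tables added). -/
def ports : Piece → List (FreeGroup (Fin 3))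
  | disc => [1]
  | pants => [la, lb, la * lb]
  | moebius => [la * la]
  | y111 => [la, la, la]
  | y12 => [la, la * la]
  | y3 => [la * la * la]
  | x8 i => x8Ports i
  | melon i => melonPorts i
  | handcuff i => handcuffPorts i

/-- Number of boundary circles (ports) of a piece. -/
def numPorts (p : Piece) : ℕ := p.ports.length

/-- The `j`-th port word of a piece (junk value `1` out of range). -/
def portWord (p : Piece) (j : ℕ) : FreeGroup (Fin 3) := p.ports.getD j 1

/-- Number of true vertices inside the piece (0, 1 for the figure-eight blocks, 2 for melons and handcuffs). -/
def numTrueVertices : Piece → ℕ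
  | x8 _ => 1
  | melon _ => 2
  | handcuff _ => 2
  | _ => 0

end Piece

/-! ## §3 Encoding graphs and their graph-of-spaces presentations (three letters per piece) -/

/-- A KMN ENCODING GRAPH at connected complexity ≤ 2: `k` pieces, `m` glued port pairs with orientation signs, a chosen
spanning tree (same data as the grade-one line's `ShadowGraph`, over the larger piece type). -/
structure ShadowGraph where
  /-- number of pieces -/
  k : ℕ
  /-- number of glued port pairs -/
  m : ℕ
  /-- the piece at each vertex of the encoding graph -/
  piece : Fin k → Piece
  /-- first port of the `e`-th gluing: (piece index, port index) -/
  src : Fin m → Fin k × ℕ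
  /-- second port of the `e`-th gluing -/
  tgt : Fin m → Fin k × ℕ
  /-- gluing orientation of the `e`-th pair of boundary circles -/
  sgn : Fin m → Bool
  /-- the edges of the chosen spanning tree (their stable letters are killed) -/
  tree : Fin m → Bool

namespace ShadowGraph

variable (G : ShadowGraph)

/-- All `2m` port references used by the gluings. -/
def endpoints : Fin G.m ⊕ Fin G.m → Fin G.k × ℕ := Sum.elim G.src G.tgt

/-- Every referenced port exists. -/
def PortsValid : Prop :=
  ∀ e : Fin G.m, (G.src e).2 < (G.piece (G.src e).1).numPorts ∧ (G.tgt e).2 < (G.piece (G.tgt e).1).numPorts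

/-- No boundary circle is glued twice. -/
def PortsInjective : Prop := Function.Injective G.endpoints

/-- The simple graph on pieces spanned by the tree edges. -/
def treeAdj : SimpleGraph (Fin G.k) :=
  SimpleGraph.fromRel fun u v => ∃ e : Fin G.m, G.tree e = true ∧ (G.src e).1 = u ∧ (G.tgt e).1 = v

/-- The tree edges form a spanning tree of the encoding graph. -/
def IsSpanningTree : Prop :=
  (∀ e, G.tree e = true → (G.src e).1 ≠ (G.tgt e).1) ∧ G.treeAdj.Connected ∧
    (Finset.univ.filter fun e => G.tree e = true).card + 1 = G.k

/-- ADMISSIBLE encoding graphs: valid ports, no port glued twice, a genuine spanning tree.  (Connected complexity ≤ 2 is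
automatic: every block is a whole component of the singular set.) -/
def Admissible : Prop := G.PortsValid ∧ G.PortsInjective ∧ G.IsSpanningTree

/-- Number of true vertices of `X_G` (sub-grading; `≤ 2` per singular component by construction). -/
def numVertices : ℕ := ∑ v, (G.piece v).numTrueVertices

/-- GENERATORS: three spine letters per piece and one stable letter per glued pair. -/
abbrev Gen : Type := (Fin G.k × Fin 3) ⊕ Fin G.m

/-- RELATOR INDICES: one gluing relator per glued pair, one killing relator per tree edge, one killing relator per unused
spine letter `(v, i)` with `rank(piece v) ≤ i`. -/
abbrev Rel : Type := Fin G.m ⊕ {e : Fin G.m // G.tree e = true} ⊕ {p : Fin G.k × Fin 3 // (G.piece p.1).rank ≤ (p.2 : ℕ)}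

/-- The spine letters of piece `v` inside the big free group. -/
def embed (v : Fin G.k) : FreeGroup (Fin 3) →* FreeGroup G.Gen :=
  FreeGroup.map fun i => Sum.inl (v, i)

/-- The word of port `(v, j)` in the big free group. -/
def portWordAt (p : Fin G.k × ℕ) : FreeGroup G.Gen := G.embed p.1 ((G.piece p.1).portWord p.2)

/-- The stable letter of the `e`-th glued pair. -/
def stable (e : Fin G.m) : FreeGroup G.Gen := FreeGroup.of (Sum.inr e)

/-- The GLUING RELATOR of the `e`-th pair: `w_src · t_e · w_tgt^{±1} · t_e⁻¹`. -/
def gluingRelator (e : Fin G.m) : FreeGroup G.Gen :=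
  G.portWordAt (G.src e) * G.stable e * (if G.sgn e then G.portWordAt (G.tgt e) else (G.portWordAt (G.tgt e))⁻¹) *
    (G.stable e)⁻¹

/-- All relators of the uniform encoding. -/
def relator : G.Rel → FreeGroup G.Gen
  | Sum.inl e => G.gluingRelator e
  | Sum.inr (Sum.inl e) => G.stable e.1
  | Sum.inr (Sum.inr p) => FreeGroup.of (Sum.inl p.1)

/-- THE PRESENTATION `P(G)`, transported to `Fin n` along bijections of the index types (balanced iff `Σ_v rank = k − 1`). -/
def presentation {n : ℕ} (eg : G.Gen ≃ Fin n) (er : G.Rel ≃ Fin n) : BalancedPresentation n :=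
  fun j => FreeGroup.map eg (G.relator (er.symm j))

end ShadowGraph

/-! ## §4a Recursive one-occurrence elimination certificates (pure free-group data) -/

namespace Roe

variable {n : ℕ}

/-- The substitution `x ↦ W⁻¹`, all other letters fixed. -/
def substHom (x : Fin n) (W : FreeGroup (Fin n)) : FreeGroup (Fin n) →* FreeGroup (Fin n) :=
  FreeGroup.lift fun y => if y = x then W⁻¹ else FreeGroup.of y

/-- One elimination step: relator index, eliminated letter, the complementary word, and a sign. -/
structure Step (n : ℕ) where
  /-- the relator used at this step -/
  rel : Fin n
  /-- the letter eliminated at this step -/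
  letter : Fin n
  /-- the word `W` with `relator ~ (letter · W)^{±1}` -/
  word : FreeGroup (Fin n)
  /-- `true`: the relator is conjugate to `letter · W`; `false`: to its inverse -/
  sgn : Bool

/-- VALIDITY of a step list from a state (accumulated substitution `Φ`, eliminated letters `E`, used relators `U`):
the next relator, AFTER the substitutions so far, is conjugate to `(x · W)^{±1}` with `x` fresh and `W` a word in the
letters that are neither eliminated nor `x`; then `x ↦ W⁻¹` is composed into `Φ`.  At the end every letter is eliminated
and every relator used. -/
def Valid (P : BalancedPresentation n) :
    List (Step n) → (FreeGroup (Fin n) →* FreeGroup (Fin n)) → Finset (Fin n) → Finset (Fin n) → Prop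
  | [], _, E, U => E = Finset.univ ∧ U = Finset.univ
  | s :: rest, Φ, E, U =>
      s.letter ∉ E ∧ s.rel ∉ U ∧
      s.word ∈ Subgroup.closure (FreeGroup.of '' {y : Fin n | y ∉ E ∧ y ≠ s.letter}) ∧
      IsConj (Φ (P s.rel))
        (if s.sgn then FreeGroup.of s.letter * s.word else (FreeGroup.of s.letter * s.word)⁻¹) ∧
      Valid P rest ((substHom s.letter s.word).comp Φ) (insert s.letter E) (insert s.rel U)

/-- `P` admits a recursive one-occurrence elimination certificate.  (The grade-one ERASURE certificates of gen 12 —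
`IsConj (erase_{rk < rk i} (P (σ i))) (xᵢ^{±1})` — are the special case `W = 1` at every step.) -/
def HasCertificate (P : BalancedPresentation n) : Prop :=
  ∃ steps : List (Step n), Valid P steps (MonoidHom.id _) ∅ ∅

end Roe

/-! ## §4b The four registered stubs and the composition -/

/-- Local abbreviation: the round 4-sphere. -/
abbrev S4 : Type := (Metric.sphere (0 : EuclideanSpace ℝ (Fin 5)) 1)

/-- STATEMENT OF STUB 1 (structure at `c* ≤ 2`): a smooth homotopy 4-sphere of connected shadow complexity ≤ 2 is the
boundary of a presentation 5-manifold `H⁵(P(G), ε)` of an ADMISSIBLE grade-two encoding graph `G` whose presentation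
presents the trivial group. -/
def KMNGraphPresentationTwo : Prop :=
  ∀ (X : Type) [TopologicalSpace X] [T2Space X] [SecondCountableTopology X]
    [ChartedSpace (EuclideanSpace ℝ (Fin 4)) X] [IsManifold (𝓡 4) ∞ X],
    X ≃ₕ S4 → HasConnectedShadowComplexityLE 2 X →
    ∃ (G : ShadowGraph) (n : ℕ) (eg : G.Gen ≃ Fin n) (er : G.Rel ≃ Fin n),
      G.Admissible ∧ (G.presentation eg er).PresentsTrivialGroup ∧
      ∃ (W : Type) (_ : TopologicalSpace W) (_ : T2Space W) (_ : SecondCountableTopology W)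
        (_ : ChartedSpace (EuclideanHalfSpace (4 + 1)) W) (_ : IsManifold (𝓡∂ (4 + 1)) ∞ W) (_ : CompactSpace W),
        IsPresentationHandlebodyFive (G.presentation eg er) W ∧
        ∃ φ : X → W, Manifold.IsSmoothEmbedding (𝓡 4) (𝓡∂ (4 + 1)) ∞ φ ∧
          Set.range φ = (𝓡∂ (4 + 1)).boundary W

/-- STATEMENT OF STUB 2 (LOAD-BEARING, combinatorial — the grade-two DICHOTOMY in certificate form): the presentation of an
admissible grade-two encoding graph that presents the trivial group admits an elimination certificate. -/
def GradeTwoDichotomy : Prop :=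
  ∀ (G : ShadowGraph) (n : ℕ) (eg : G.Gen ≃ Fin n) (er : G.Rel ≃ Fin n),
    G.Admissible → (G.presentation eg er).PresentsTrivialGroup → Roe.HasCertificate (G.presentation eg er)

/-- STATEMENT OF STUB 3 (pure algebra): an elimination certificate implies Andrews–Curtis triviality (no stabilisation). -/
def RoeSound : Prop :=
  ∀ (n : ℕ) (P : BalancedPresentation n), Roe.HasCertificate P →
    IsAndrewsCurtisEquivalent P (BalancedPresentation.trivial n)

/-- The grade-two Andrews–Curtis statement (shape of the grade-one `GradeOneAC`, over the larger piece table). -/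
def GradeTwoAC : Prop :=
  ∀ (G : ShadowGraph) (n : ℕ) (eg : G.Gen ≃ Fin n) (er : G.Rel ≃ Fin n),
    G.Admissible → (G.presentation eg er).PresentsTrivialGroup →
    IsStablyAndrewsCurtisEquivalent (G.presentation eg er) (BalancedPresentation.trivial n)

/-- PROVED: soundness + dichotomy give the grade-two Andrews–Curtis statement (with `k = 0` stabilisations). -/
theorem gradeTwoAC_of (hs : RoeSound) (hd : GradeTwoDichotomy) : GradeTwoAC :=
  fun G n eg er hadm htriv => ⟨0, hs n _ (hd G n eg er hadm htriv)⟩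

/-- STUB 1 (registered) — structure theorem at `c* ≤ 2`, presentation form.  Size L. -/
theorem stub_kmnGraphPresentationTwo : KMNGraphPresentationTwo := by
  sorry

/-- STUB 2 (registered, LOAD-BEARING) — the grade-two dichotomy (ownership levels + local table; gen13 NODE §2–§4).  Size L. -/
theorem stub_gradeTwoDichotomy : GradeTwoDichotomy := by
  sorry

/-- STUB 3 (registered) — soundness of elimination certificates.  Size M (tree lemmas `update_mul_of_mem_normalClosure`,
`update_of_isConj`, `isAndrewsCurtisEquivalent_trivial_of_isConj_erase`). -/
theorem stub_roeSound : RoeSound := by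
  sorry

/-- STUB 4 (registered; the tree's NAMED FACT by name — Andrews–Curtis 1965, Hog-Angeloni–Metzler Ch. I Thm 3.4). -/
theorem stub_acFiveBall :
    IsPresentationHandlebodyFive.nonempty_diffeomorph_closedBall_of_isStablyAndrewsCurtisEquivalent := by
  sorry

/-- Informational (PROVED, not used below): the tree's open Andrews–Curtis conjecture dominates the combinatorial content. -/
theorem gradeTwoAC_of_andrewsCurtisConjecture (h : AndrewsCurtisConjecture) : GradeTwoAC :=
  fun G n eg er _ htriv => h n (G.presentation eg er) htriv

/-- The boundary step (PROVED): if `X` is embedded as the boundary of `W` and `W ≅ 𝔻⁵` then `X ≅ S⁴`. -/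
theorem nonempty_diffeomorph_sphere_of_boundary
    (X : Type) [TopologicalSpace X] [ChartedSpace (EuclideanSpace ℝ (Fin 4)) X] [IsManifold (𝓡 4) ∞ X]
    (W : Type) [TopologicalSpace W] [ChartedSpace (EuclideanHalfSpace (4 + 1)) W]
    (φ : X → W) (hφ : Manifold.IsSmoothEmbedding (𝓡 4) (𝓡∂ (4 + 1)) ∞ φ)
    (hr : Set.range φ = (𝓡∂ (4 + 1)).boundary W)
    (g : W ≃ₘ⟮𝓡∂ (4 + 1), 𝓡∂ (4 + 1)⟯ (Metric.closedBall (0 : EuclideanSpace ℝ (Fin (4 + 1))) 1)) :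
    Nonempty (X ≃ₘ⟮𝓡 4, 𝓡 4⟯ S4) :=
  let bW : BoundaryData (𝓡∂ (4 + 1)) W (𝓡 4) :=
    { carrier := X, incl := φ, isSmoothEmbedding := hφ, range_incl := hr }
  ⟨bW.restrictDiffeomorph (closedBallBoundaryData 4) g⟩

/-- **`DoublesShadowTwo_of` — THE SKELETON**: STUB 1 → (STUB 3 + STUB 2 ⟹ `GradeTwoAC`) → STUB 4 → the crux
`RootDecompAE.DoublesShadowTwo` BY NAME (real proof, no sorry of its own; neither the `IsDouble` hypothesis nor the negated
`c* ≤ 1` hypothesis is used — the line closes the whole `c* ≤ 2` row of homotopy spheres). -/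
theorem DoublesShadowTwo_of :
    Summit.SmoothPoincare4.SmoothPoincare4.Theses.RootDecompAE.DoublesShadowTwo := by
  intro C _ _ _ _ _ _ _ bC X _ _ _ _ _ e hD hnot hc
  obtain ⟨G, n, eg, er, hadm, htriv, W, _, _, _, _, _, _, hPW, φ, hφ, hr⟩ := stub_kmnGraphPresentationTwo X e hc
  obtain ⟨g⟩ := stub_acFiveBall n (G.presentation eg er) W hPW
    (gradeTwoAC_of stub_roeSound stub_gradeTwoDichotomy G n eg er hadm htriv)
  exact nonempty_diffeomorph_sphere_of_boundary X W φ hφ hr g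

#print axioms DoublesShadowTwo_of
#print axioms gradeTwoAC_of
#print axioms nonempty_diffeomorph_sphere_of_boundary

/-! ## §5 Inhabitedness and sanity examples -/

namespace Examples

open Piece ShadowGraph

/-- The melon block 42 (ports `bA, cA, BcbCA` — one of the five unimodular owned triples that are NOT letter-triangular)
with its three ports capped by discs: balanced (`Σ rank = 3 = k − 1`), presents the trivial group (`b = a`, `c = a`,
then `a = 1`), eliminable by substitution but not by erasure. -/
def exMelon42 : ShadowGraph where
  k := 4
  m := 3
  piece := ![melon 42, disc, disc, disc]
  src := fun e => (0, (e : ℕ))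
  tgt := fun e => (Fin.succ e, 0)
  sgn := fun _ => true
  tree := fun _ => true

/-- `exMelon42` is balanced: 15 generators … -/
example : Fintype.card exMelon42.Gen = 15 := by decide
/-- … and 15 relators (3 gluing, 3 tree, 9 unused letters of the discs). -/
example : Fintype.card exMelon42.Rel = 15 := by decide

/-- A one-step certificate in rank one: `⟨x₀ ∣ x₀⟩` is certified by the single step `(0, 0, 1, +)`. -/
example : Roe.HasCertificate (BalancedPresentation.trivial 1) := by
  refine ⟨[⟨0, 0, 1, true⟩], ?_⟩
  simp only [Roe.Valid]
  refine ⟨by simp, by simp, Subgroup.one_mem _, ?_, ?_, ?_⟩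
  · simpa [BalancedPresentation.trivial] using IsConj.refl (FreeGroup.of (0 : Fin 1))
  · ext i; simp [Fin.fin_one_eq_zero i]
  · ext i; simp [Fin.fin_one_eq_zero i]

end Examples

end Summit.SmoothPoincare4.SmoothPoincare4.Cruxes.DoublesShadowTwo.GradeTwoAC

end
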